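import Summits.KontsevichZagierPeriods.Zeta5Search.LaiSweepShard

/-!
# `κ₃` sweep certificate — shard file 005 of 127 (shards 35–41 of 889)

HONEST FRAMING. Systematic search; no irrationality claim unless certified. This file only checks,
by `decide +kernel`, shards 35–41 of the order-cell sweep of the `κ₃` point `(74, 2180, 444; δ74)`
(engine `LaiSweepEngine`, soundness `LaiSweepJump/Free/Eval/Shard/Kappa3`; a shard is `⟨regime, n,
p, q, p', q', Lo, Up⟩`: `n` cells from `p/q` to `p'/q'` with integer rate sums in `[Lo, Up]`, `K =
128`, `D = 2^40`). It draws NO conclusion: only the capstone `LaiKappa3SweepCert`, which needs all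
127 shard files, does. Kernel cost of this file ≈ 560 cells × 0.3 s.
-/

namespace Summit.KontsevichZagierPeriods.Zeta5Search.Sweep

set_option maxHeartbeats 100000000 in
/-- Shard 35: 80 cells of regime A from `23/2192` to `12/1115`.
[cite: Lai2024BallRivoal, §4 Lemma 4.3] -/
theorem shard035 :
    Shard.check 128 (2^40)
      ⟨false, 80, 23, 2192, 12, 1115, 181177512466045, 181264211224890⟩ = true := by
  decide +kernel

set_option maxHeartbeats 100000000 in
/-- Shard 36: 80 cells of regime A from `12/1115` to `14/1269`.
[cite: Lai2024BallRivoal, §4 Lemma 4.3] -/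
theorem shard036 :
    Shard.check 128 (2^40)
      ⟨false, 80, 12, 1115, 14, 1269, 174436170932076, 174516513475063⟩ = true := by
  decide +kernel

set_option maxHeartbeats 100000000 in
/-- Shard 37: 80 cells of regime A from `14/1269` to `4/355`.
[cite: Lai2024BallRivoal, §4 Lemma 4.3] -/
theorem shard037 :
    Shard.check 128 (2^40)
      ⟨false, 80, 14, 1269, 4, 355, 145922477587444, 145989390691625⟩ = true := by
  decide +kernel

set_option maxHeartbeats 100000000 in
/-- Shard 38: 80 cells of regime A from `4/355` to `15/1307`.
[cite: Lai2024BallRivoal, §4 Lemma 4.3] -/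
theorem shard038 :
    Shard.check 128 (2^40)
      ⟨false, 80, 4, 355, 15, 1307, 126697163114036, 126746469886022⟩ = true := by
  decide +kernel

set_option maxHeartbeats 100000000 in
/-- Shard 39: 80 cells of regime A from `15/1307` to `1/85`.
[cite: Lai2024BallRivoal, §4 Lemma 4.3] -/
theorem shard039 :
    Shard.check 128 (2^40)
      ⟨false, 80, 15, 1307, 1, 85, 191414238560595, 191512959125263⟩ = true := by
  decide +kernel

set_option maxHeartbeats 100000000 in
/-- Shard 40: 80 cells of regime A from `1/85` to `31/2594`.
[cite: Lai2024BallRivoal, §4 Lemma 4.3] -/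
theorem shard040 :
    Shard.check 128 (2^40)
      ⟨false, 80, 1, 85, 31, 2594, 125392849505178, 125438386088993⟩ = true := by
  decide +kernel

set_option maxHeartbeats 100000000 in
/-- Shard 41: 80 cells of regime A from `31/2594` to `31/2534`.
[cite: Lai2024BallRivoal, §4 Lemma 4.3] -/
theorem shard041 :
    Shard.check 128 (2^40)
      ⟨false, 80, 31, 2594, 31, 2534, 178230167241543, 178318175037277⟩ = true := by
  decide +kernel

/-- The checked shards of this file, in order. [folklore] -/
def shards005 : List (CheckedShard 128 (2^40)) :=
  [⟨_, shard035⟩, ⟨_, shard036⟩, ⟨_, shard037⟩, ⟨_, shard038⟩, ⟨_, shard039⟩,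
    ⟨_, shard040⟩, ⟨_, shard041⟩]

end Summit.KontsevichZagierPeriods.Zeta5Search.Sweep
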